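import Summits.BirchSwinnertonDyer.BirchSwinnertonDyer.Theorems.ThetaPartnerAtTwoSignedKatoUpToAtTwoPointsPackageTransfer
import Summits.BirchSwinnertonDyer.BirchSwinnertonDyer.Theorems.ThetaPartnerAtTwoSignedKatoUpToAtTwoColGlue
import HarnessLib

/-!
# Route `ThetaPartnerAtTwo` (TP2), crux K3 `SignedKatoDivisibilityUpToAtTwo` (item stmt-BirchSwinnertonDyer-20308),
# line `colemanrat` — (R2b) REDUCED TO LAYER CURRENCY (R2c): the transfer theorem

Lead `bsd-wall-tp2-p2x` g4 (cell `bsd-wall`). HONEST FRAMING: ONE THEOREM, an implication between two fully spelled statements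
(no definition, no named fact, no instance, no `sorry`); closes no item; BSD is NOT proved by any of this.

(R2b) = v6's registered research stub `stub_h1SideTwoInv` speaks of ONE additive map `col₀ : 𝐇¹ → Hom(E(ℚ_{2,∞}·ℚ_v), ℤ₂)`
intertwining `Λ` with Sprung's `lambdaSMul`. The width seat w2 g3's `ColGlue.exists_col_linear` (p601049) builds such a `col₀` — with
its `Λ`-compatibility — from ANY family of LAYER pairings `pair n : H¹(ℚ_n, T₂W) →ₗ[ℤ₂] Hom(E(ℚ_{2,n}·ℚ_v), ℤ₂)` satisfying the
projection formula (P1) and Galois invariance (P2). So the research residue can be stated one level closer to the definition item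
«the `T₂E`-adic local Tate pairing, LAYER BY LAYER» and to what Poitou–Tate delivers (an identity at a finite layer): (R2c) = «∃ local
lift `g`, plus Honda system `d` ((L)(TR)(GEN)(GEN₀)), pinned `I`, layer pairings `pair` with (P1)(P2)_g, (PT-orth) at every layer `n`
«`2^{-k}·2^m·⟨proj_n x, 2^k Q⟩_n ≡ 0` for every Kummer witness `(φ, Q, k)` of every `⁺`-Selmer class with `2^k Q ∈ E(ℚ_{2,n}·ℚ_v) ∩ A⁺`»,
a genuine 2-adic Euler-system class `s`, and (ERL♭) for the glued functional of `s`». This file: (R2c) ⟹ (R2b).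

## What is proved
* `SignedKatoOffTwo.h1SideTwoInv_of_layerSideTwoInv` — (R2c) → (R2b) verbatim: `col₀ :=` the glue of `pair` (`ColGlue.exists_col_linear`:
  additive, `Λ`-compatible, layer formula); (REC₀) of (R2b) from (PT-orth) at the layer of `2^k Q` (`col₀ (C(2)^m • x) = 2^m • col₀ x`
  by `lambdaSMul_C`); (ES) and (ERL♭) carried over (the latter is stated in (R2c) for every `col₀` with the layer formula).

References: [Kato2004Asterisque] §12.2, §17.13; [PerrinRiou1994Invent] §3.6.1; [Kobayashi2003] (7.17)–(7.21); [Sprung2012] Def. 5.9.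
-/

set_option autoImplicit false
-- the Theorems namespace of this sub repeats the summit name by design (D-0017 nested layout)
set_option linter.dupNamespace false

noncomputable section

open scoped Classical MatrixGroups ModularForm NumberField

open CongruenceSubgroup WeierstrassCurve Field IsDedekindDomain NumberField
  Literature.NumberTheory.GaloisRepresentations
  Literature.NumberTheory.EllipticCurves Literature.NumberTheory.EllipticCurves.ModularForms
  Literature.NumberTheory.EllipticCurves.Module Literature.NumberTheory.EllipticCurves.Rank1Residual
  Literature.NumberTheory.EllipticCurves.Kobayashi2003 Literature.NumberTheory.EllipticCurves.Kato2004
  Literature.NumberTheory.EllipticCurves.Kato2004.EulerSystemValues Literature.NumberTheory.EllipticCurves.GreenbergSelmer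
  Literature.NumberTheory.EllipticCurves.Sprung2012
  ZpExtension Summit.BirchSwinnertonDyer.Rank1Residual.Supersingular

namespace Summit.BirchSwinnertonDyer.BirchSwinnertonDyer.Theorems.SignedKatoOffTwo

/-- **(R2c) ⟹ (R2b): the `𝐇¹`-side of the package follows from its LAYER-CURRENCY form.** Hypothesis (R2c): per `v ∋ 2`, habitat
data and height-one `𝔭 ∌ 2`, some local lift `g`, plus Honda system `d`, pinned `I = 𝐇¹_Γ(T₂E)`, `ℤ₂`-linear layer pairings
`pair n : H¹(ℚ_n, T₂W) → Hom(E(ℚ_{2,n}·ℚ_v), ℤ₂)` with (P1) `⟨cor x, Q⟩_n = ⟨x, Q⟩_{n+1}` and (P2) `⟨conj_g y, g Q⟩_n = ⟨y, Q⟩_n`,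
(PT-orth) at every layer, a genuine 2-adic Euler-system class `s`, and (ERL♭) for every glue `col₀` of `pair`. Conclusion: (R2b)
VERBATIM (v6's `stub_h1SideTwoInv`), with `col₀ :=` `ColGlue.exists_col_linear`. [cite: Kato2004Asterisque, §12.2 (p. 220), §17.13 (p. 279)]
[cite: PerrinRiou1994Invent, §3.6.1] [cite: Kobayashi2003, (7.17)–(7.21) (p. 12)] -/
theorem h1SideTwoInv_of_layerSideTwoInv
    (h : ∀ (v : HeightOneSpectrum (𝓞 ℚ)), ((2 : ℕ) : 𝓞 ℚ) ∈ v.asIdeal →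
      ∀ (W : WeierstrassCurve ℚ) [W.IsElliptic] [W.IsGloballyMinimal],
        ¬ W.HasCM → W.analyticRank = 0 → GoodSS W 2 → W.frobeniusTrace 2 = 0 →
        ∀ (κ : ZpExtension ℚ 2) (γ : Field.absoluteGaloisGroup ℚ) (hκ : κ.IsCyclotomic),
          κ.IsTopGenerator γ → IsCyclotomicVariable 2 γ →
          ∀ [NeZero (W.conductorNorm ℤ)] (f : CuspForm (Gamma0 (W.conductorNorm ℤ)) 2),
            IsNewformOf W f → ∀ (ϖ : ℚ), (ϖ : ℝ) * W.realPeriodRat = plusPeriod f →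
          ∀ (Lplus Lminus : IwasawaAlgebra 2), IsPollackPair f 2 Lplus Lminus →
          ∀ [ContinuousSMul ℤ_[2] (W.tateModule 2)] [Module.Free ℤ_[2] (W.tateModule 2)]
            [Module.Finite ℤ_[2] (W.tateModule 2)],
          ∀ 𝔭 : PrimeSpectrum (IwasawaAlgebra 2), 𝔭.asIdeal.height = 1 →
            PowerSeries.C (2 : ℤ_[2]) ∉ 𝔭.asIdeal →
          ∃ (g : absoluteGaloisGroup (v.adicCompletion ℚ))
            (_ : κ.IsTopGenerator (resGalOfEmb (closureEmb (K := ℚ) (v.adicCompletion ℚ)) g))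
            (d : ℕ → localPoints W (v.adicCompletion ℚ))
            (I : Kato2004.IwasawaH1Data W 2 κ γ)
            (pair : ∀ n : ℕ, H1 (tateRep W 2) (κ.layerSubgroup n) →ₗ[ℤ_[2]]
              (localLayerPointsOfEmb κ (closureEmb (K := ℚ) (v.adicCompletion ℚ)) W n →+ ℤ_[2]))
            (s : I.H) (m : ℕ),
            (∀ n, d n ∈ localLayerPointsOfEmb κ (closureEmb (K := ℚ) (v.adicCompletion ℚ)) W n) ∧
            (∀ n, localTraceOfEmb κ (closureEmb (K := ℚ) (v.adicCompletion ℚ)) W (n + 1) (n + 2) (d (n + 2)) = -d n) ∧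
            (∀ n : ℕ, 1 ≤ n → ∀ P ∈ localLayerPointsOfEmb κ (closureEmb (K := ℚ) (v.adicCompletion ℚ)) W n,
              ∃ B ∈ AddSubgroup.closure (Set.range fun σ : absoluteGaloisGroup (v.adicCompletion ℚ) ↦ σ • d n),
                ∃ P' ∈ localLayerPointsOfEmb κ (closureEmb (K := ℚ) (v.adicCompletion ℚ)) W (n - 1),
                ∃ R ∈ localLayerPointsOfEmb κ (closureEmb (K := ℚ) (v.adicCompletion ℚ)) W n, P = B + P' + 2 • R) ∧
            (∀ P ∈ localLayerPointsOfEmb κ (closureEmb (K := ℚ) (v.adicCompletion ℚ)) W 0,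
              ∃ a : ℤ, ∃ R ∈ localLayerPointsOfEmb κ (closureEmb (K := ℚ) (v.adicCompletion ℚ)) W 0, P = a • d 0 + 2 • R) ∧
            (∀ (n : ℕ) (x : H1 (tateRep W 2) (κ.layerSubgroup (n + 1))) (Q : localPoints W (v.adicCompletion ℚ))
              (hQ : Q ∈ localLayerPointsOfEmb κ (closureEmb (K := ℚ) (v.adicCompletion ℚ)) W n),
              pair n (layerCores (tateRep W 2) κ n x) ⟨Q, hQ⟩ =
                pair (n + 1) x ⟨Q, localLayerPointsOfEmb_mono κ (closureEmb (K := ℚ) (v.adicCompletion ℚ)) W (Nat.le_succ n) hQ⟩) ∧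
            (∀ (n : ℕ) (y : H1 (tateRep W 2) (κ.layerSubgroup n)) (Q : localPoints W (v.adicCompletion ℚ))
              (hQ : Q ∈ localLayerPointsOfEmb κ (closureEmb (K := ℚ) (v.adicCompletion ℚ)) W n),
              pair n (conjMap (tateRep W 2).toTopRep (κ.layerSubgroup n) (resGalOfEmb (closureEmb (K := ℚ) (v.adicCompletion ℚ)) g) 1 y)
                ⟨g • Q, smul_mem_localLayerPointsOfEmb κ (closureEmb (K := ℚ) (v.adicCompletion ℚ)) W n g hQ⟩ = pair n y ⟨Q, hQ⟩) ∧
            (∀ (n : ℕ) (x : I.H) (t : W.subgroupH1 2 κ.kerSubgroup), t ∈ signedSelmerInfty W κ 1 →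
              ∀ (φ : contOneCocycles (discreteTopRep κ.kerSubgroup (W.geomPrimaryTorsion 2)))
                (Q : localPoints W (v.adicCompletion ℚ)) (k : ℕ), oneCocycleClass _ φ = t →
              ∀ hQn : 2 ^ k • Q ∈ localLayerPointsOfEmb κ (closureEmb (K := ℚ) (v.adicCompletion ℚ)) W n,
              2 ^ k • Q ∈ (⨆ n, signedLocalPoints κ (v.adicCompletion ℚ) W 1 n) →
              (∀ τ : localSubgroupOfEmb κ.kerSubgroup (closureEmb (K := ℚ) (v.adicCompletion ℚ)),
                pointsMapOfEmb W (closureEmb (K := ℚ) (v.adicCompletion ℚ))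
                    ((φ.1 (resGalSubgroupOfEmb κ.kerSubgroup _ τ) : W.geomPrimaryTorsion 2) : W.geomPoints) =
                  (τ : absoluteGaloisGroup (v.adicCompletion ℚ)) • Q - Q) →
              (PadicInt.toZModPow k (2 ^ m * pair n (I.proj n x) ⟨2 ^ k • Q, hQn⟩)).val •
                ((((2 : ℚ) ^ k)⁻¹ : ℚ) : AddCircle (1 : ℚ)) = 0) ∧
            Kato2004.IsEulerSystemClassTwo W hκ I s ∧
            (∀ col₀ : I.H →+ (localTowerPointsOfEmb κ (closureEmb (K := ℚ) (v.adicCompletion ℚ)) W →+ ℤ_[2]),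
              (∀ (n : ℕ) (x : I.H) (Q : localPoints W (v.adicCompletion ℚ)) (hQ : Q ∈ localLayerPointsOfEmb κ (closureEmb (K := ℚ) (v.adicCompletion ℚ)) W n),
                col₀ x ⟨Q, localLayerPointsOfEmb_le_localTowerPointsOfEmb κ (closureEmb (K := ℚ) (v.adicCompletion ℚ)) W n hQ⟩ = pair n (I.proj n x) ⟨Q, hQ⟩) →
              ∀ Ls Lf : IwasawaAlgebra 2, IsColemanPair κ (closureEmb (K := ℚ) (v.adicCompletion ℚ)) W 0 g d (col₀ s) Ls Lf →
                lengthAt (IwasawaAlgebra 2) (IwasawaAlgebra 2 ⧸ Ideal.span {Lf}) 𝔭 ≤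
                  lengthAt (IwasawaAlgebra 2) (IwasawaAlgebra 2 ⧸ Ideal.span {kobayashiL 1 Lplus Lminus}) 𝔭)) :
    ∀ (v : HeightOneSpectrum (𝓞 ℚ)), ((2 : ℕ) : 𝓞 ℚ) ∈ v.asIdeal →
    ∀ (W : WeierstrassCurve ℚ) [W.IsElliptic] [W.IsGloballyMinimal],
      ¬ W.HasCM → W.analyticRank = 0 → GoodSS W 2 → W.frobeniusTrace 2 = 0 →
      ∀ (κ : ZpExtension ℚ 2) (γ : Field.absoluteGaloisGroup ℚ) (hκ : κ.IsCyclotomic),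
        κ.IsTopGenerator γ → IsCyclotomicVariable 2 γ →
        ∀ [NeZero (W.conductorNorm ℤ)] (f : CuspForm (Gamma0 (W.conductorNorm ℤ)) 2),
          IsNewformOf W f → ∀ (ϖ : ℚ), (ϖ : ℝ) * W.realPeriodRat = plusPeriod f →
        ∀ (Lplus Lminus : IwasawaAlgebra 2), IsPollackPair f 2 Lplus Lminus →
        ∀ [ContinuousSMul ℤ_[2] (W.tateModule 2)] [Module.Free ℤ_[2] (W.tateModule 2)]
          [Module.Finite ℤ_[2] (W.tateModule 2)],
        ∀ 𝔭 : PrimeSpectrum (IwasawaAlgebra 2), 𝔭.asIdeal.height = 1 →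
          PowerSeries.C (2 : ℤ_[2]) ∉ 𝔭.asIdeal →
        ∃ (g : absoluteGaloisGroup (v.adicCompletion ℚ))
          (hg : κ.IsTopGenerator (resGalOfEmb (closureEmb (K := ℚ) (v.adicCompletion ℚ)) g))
          (d : ℕ → localPoints W (v.adicCompletion ℚ))
          (I : Kato2004.IwasawaH1Data W 2 κ γ)
          (col₀ : I.H →+ (localTowerPointsOfEmb κ (closureEmb (K := ℚ) (v.adicCompletion ℚ)) W →+ ℤ_[2]))
          (s : I.H) (m : ℕ),
          (∀ n, d n ∈ localLayerPointsOfEmb κ (closureEmb (K := ℚ) (v.adicCompletion ℚ)) W n) ∧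
          (∀ n, localTraceOfEmb κ (closureEmb (K := ℚ) (v.adicCompletion ℚ)) W (n + 1) (n + 2) (d (n + 2)) = -d n) ∧
          (∀ n : ℕ, 1 ≤ n → ∀ P ∈ localLayerPointsOfEmb κ (closureEmb (K := ℚ) (v.adicCompletion ℚ)) W n,
            ∃ B ∈ AddSubgroup.closure (Set.range fun σ : absoluteGaloisGroup (v.adicCompletion ℚ) ↦ σ • d n),
              ∃ P' ∈ localLayerPointsOfEmb κ (closureEmb (K := ℚ) (v.adicCompletion ℚ)) W (n - 1),
              ∃ R ∈ localLayerPointsOfEmb κ (closureEmb (K := ℚ) (v.adicCompletion ℚ)) W n, P = B + P' + 2 • R) ∧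
          (∀ P ∈ localLayerPointsOfEmb κ (closureEmb (K := ℚ) (v.adicCompletion ℚ)) W 0,
            ∃ a : ℤ, ∃ R ∈ localLayerPointsOfEmb κ (closureEmb (K := ℚ) (v.adicCompletion ℚ)) W 0, P = a • d 0 + 2 • R) ∧
          (∀ (r : IwasawaAlgebra 2) (x : I.H),
            col₀ (r • x) = lambdaSMul κ (closureEmb (K := ℚ) (v.adicCompletion ℚ)) W hg r (col₀ x)) ∧
          (∀ (x : I.H) (t : W.subgroupH1 2 κ.kerSubgroup), t ∈ signedSelmerInfty W κ 1 →
            ∀ (φ : contOneCocycles (discreteTopRep κ.kerSubgroup (W.geomPrimaryTorsion 2)))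
              (Q : localPoints W (v.adicCompletion ℚ)) (k : ℕ), oneCocycleClass _ φ = t →
            ∀ hQ : 2 ^ k • Q ∈ (⨆ n, signedLocalPoints κ (v.adicCompletion ℚ) W 1 n),
            (∀ τ : localSubgroupOfEmb κ.kerSubgroup (closureEmb (K := ℚ) (v.adicCompletion ℚ)),
              pointsMapOfEmb W (closureEmb (K := ℚ) (v.adicCompletion ℚ))
                  ((φ.1 (resGalSubgroupOfEmb κ.kerSubgroup _ τ) : W.geomPrimaryTorsion 2) : W.geomPoints) =
                (τ : absoluteGaloisGroup (v.adicCompletion ℚ)) • Q - Q) →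
            (PadicInt.toZModPow k
                (col₀ ((PowerSeries.C (2 : ℤ_[2]) : IwasawaAlgebra 2) ^ m • x)
                  ⟨2 ^ k • Q, KummerPoint.iSup_signedLocalPoints_le_localTowerPointsOfEmb W 2 κ 1 v hQ⟩)).val •
              ((((2 : ℚ) ^ k)⁻¹ : ℚ) : AddCircle (1 : ℚ)) = 0) ∧
          Kato2004.IsEulerSystemClassTwo W hκ I s ∧
          (∀ Ls Lf : IwasawaAlgebra 2,
            IsColemanPair κ (closureEmb (K := ℚ) (v.adicCompletion ℚ)) W 0 g d (col₀ s) Ls Lf →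
            lengthAt (IwasawaAlgebra 2) (IwasawaAlgebra 2 ⧸ Ideal.span {Lf}) 𝔭 ≤
              lengthAt (IwasawaAlgebra 2) (IwasawaAlgebra 2 ⧸ Ideal.span {kobayashiL 1 Lplus Lminus}) 𝔭) := by
  intro v hv W _ _ hCM hr hss ha κ γ hκ hγ hcyc _ f hf ϖ hϖ Lplus Lminus hPo _ _ _ 𝔭 h𝔭 hC
  obtain ⟨g, hg, d, I, pair, s, m, hL, hTR, hGEN, hGEN0, hP1, hP2, hPT, hES, hERL⟩ :=
    h v hv W hCM hr hss ha κ γ hκ hγ hcyc f hf ϖ hϖ Lplus Lminus hPo 𝔭 h𝔭 hC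
  obtain ⟨col₀, hlin, hlayer⟩ :=
    ColGlue.exists_col_linear I (closureEmb (K := ℚ) (v.adicCompletion ℚ)) pair hγ hg hP1 hP2
  refine ⟨g, hg, d, I, col₀, s, m, hL, hTR, hGEN, hGEN0, hlin, ?_, hES, hERL col₀ hlayer⟩
  intro x t ht φ Q k hφ hQ hτ
  obtain ⟨n, hQn⟩ := exists_mem_localLayerPointsOfEmb_of_mem_localTowerPointsOfEmb κ
    (closureEmb (K := ℚ) (v.adicCompletion ℚ)) W (KummerPoint.iSup_signedLocalPoints_le_localTowerPointsOfEmb W 2 κ 1 v hQ)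
  have e : col₀ ((PowerSeries.C (2 : ℤ_[2]) : IwasawaAlgebra 2) ^ m • x)
      ⟨2 ^ k • Q, KummerPoint.iSup_signedLocalPoints_le_localTowerPointsOfEmb W 2 κ 1 v hQ⟩ =
      2 ^ m * pair n (I.proj n x) ⟨2 ^ k • Q, hQn⟩ := by
    rw [← map_pow, hlin, lambdaSMul_C, AddMonoidHom.smul_apply, smul_eq_mul, ← hlayer n x (2 ^ k • Q) hQn]
  rw [e]
  exact hPT n x t ht φ Q k hφ hQn hQ hτ

end Summit.BirchSwinnertonDyer.BirchSwinnertonDyer.Theorems.SignedKatoOffTwo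

end
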